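import Summits.RiemannHypothesis.RiemannHypothesis.Theorems.HandoffDecomposition
import HarnessLib

/-!
# The HANDOFF decomposition — consequences: window ends, the first failing window, the vacuity trap, the aggregate shadow

Cell `rh-explicit`, TRACK «HANDOFF» (seat handoff-theory-1).  Companion of the statement file
`HandoffDecomposition.lean` (`HandoffH`, `HandoffBase`, `HandoffStep`, `HandoffTarget`, `handoffTarget_holds`), of
prove-2's `HandoffWindow.lean` (`Handoff.deficit`, `Handoff.contribution`, the window identity) and of the text
`HOME/handoff/HANDOFF-STATEMENT.md`.  HONEST FRAMING as there: nothing here is a step towards RH; every statement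
is an unconditional consequence of Weil's criterion as discharged in the tree, or bookkeeping.

## What is proved (standard axioms; definitions `handoffCap`, `HandoffNormBound`; no named facts)

* §1 `contribution_eq_zero_of_narrow` — at the LEFT end of the window (`g ∈ C((log q)/2)`) the prime `q`
  contributes nothing; `handoffH_three_iff : HandoffH 3 ↔ WeilPositivityOn ((log 5)/2)` — the first OPEN instance, as
  a tree rung (tree reach `WeilPositivityOn (4023/5000)`, `0.8046 < (log 5)/2 = 0.80471…`).
* §2 `exists_first_failure_of_not_riemannHypothesis` — under `¬RH` the nested family `H(q)` fails from ONE prime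
  `q₁ ≥ 3` on (Yoshida's break point lies in the window before `q₁`), and the VACUITY TRAP
  `exists_forall_handoffStep : ∃ q₀, ∀ primes q ≥ q₀, HandoffStep q` — a THEOREM by excluded middle, so «the
  increment holds for all large q» is NOT a target (only `Base ∧ ∀ q` is; idea-1 §0 / prove-1 §1, typed).
* §3 the AGGREGATE SHADOW, with the SHARP constant: `norm_weilConv_weilReflect_le_half` (`|k_g(L)| ≤ ½‖g‖₂²` when
  `tsupport g ⊆ [−t,t]`, `t < L`: the two edge layers `[L−t, t]`, `[−t, t−L]` are disjoint), hence
  `abs_contribution_le : |contribution q g| ≤ cap(q) ‖g‖₂²`, `cap(q) = (log q)/√q` (`handoffCap`), and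
  `HandoffH.deficit_le` / `HandoffH.normBound` (`H(q) ⟹ N(q) : deficit q g ≤ cap(q) ‖g‖₂²` on the window = the cell's
  load `r ≤ 1`); NOT conversely at fixed `q` (sup of a sum ≠ sum of sups = the cell's non-additive `I_S`), but IN THE
  LIMIT it is RH: `riemannHypothesis_of_frequently_normBound` (N(q) for infinitely many primes ⟹ RH, since
  `cap(q) → 0` and on `C((log q)/2)` the old form is Weil's form) and `riemannHypothesis_iff_forall_normBound`
  (prove-1 ATTEMPT-1 §2–§4 and Thm 2, typed) — uniformity in `q` at the norm level IS RH; window by window it is not.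

References: as in `HandoffDecomposition.lean` [Bombieri2000Weil, Thm 2, §4; Yoshida1992HermitianForms Thm 1, Prop. 6;
Connes1999 §VII Thm 4; ConnesConsani2023 §2.1.2, §2.2–2.4].
-/

set_option linter.dupNamespace false  -- the mandated namespace repeats `RiemannHypothesis`

noncomputable section

open Set MeasureTheory Literature.NumberTheory.LFunctions
open Summit.RiemannHypothesis.RiemannHypothesis.Theorems.MotivicDoor.Semilocal
open Summit.RiemannHypothesis.RiemannHypothesis.Theorems.MotivicDoor.SemilocalThreshold
open scoped ComplexConjugate

namespace Summit.RiemannHypothesis.RiemannHypothesis.Theorems.HandoffDecomposition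

variable {q : ℕ} {g : ℝ → ℂ}

/-! ## §1  The two ends of the window; the first open instance -/

/-- At the LEFT end of the window the contribution vanishes: if `g ∈ C((log q)/2)` then `k(± log q) = 0` and
`contribution q g = 0` — there `H(q)` is just positivity of the old form, i.e. the previous condition.
[folklore] -/
theorem contribution_eq_zero_of_narrow (hg : IsWeilTest g)
    (hsupp : tsupport g ⊆ Icc (-(Real.log q / 2)) (Real.log q / 2)) :
    Handoff.contribution q g = 0 := by
  rw [contribution_eq_two_mul]
  have hk : IsWeilTest (weilConv g (weilReflect g)) := hg.weilConv hg.weilReflect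
  have hks := tsupport_weilConv_weilReflect_subset (a := Real.log q / 2) hg.2 hsupp
  rw [show 2 * (Real.log q / 2) = Real.log q by ring] at hks
  have hzero : weilConv g (weilReflect g) (Real.log q) = 0 := by
    by_contra hne
    have hmem := support_subset_Ioo_of_tsupport_subset_Icc hk.1.continuous hks (Function.mem_support.2 hne)
    exact lt_irrefl _ (mem_Ioo.1 hmem).2
  simp [hzero]

/-- `nextPrime 3 = 5`. [folklore] -/
theorem nextPrime_three : nextPrime 3 = 5 := by
  refine le_antisymm (nextPrime_le (by norm_num) (by norm_num)) ?_
  by_contra h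
  have h4 : nextPrime 3 = 4 := by have := lt_nextPrime 3; omega
  exact absurd (nextPrime_prime 3) (by rw [h4]; decide)

/-- `H(3)` is EXACTLY the open rung `WeilPositivityOn ((log 5)/2)` (tree reach: `4023/5000 = 0.8046 < (log 5)/2 =
0.80471…`; DATA a*({2,3}) ≈ 0.80723, certified wall ≤ 0.8072). [folklore] -/
theorem handoffH_three_iff : HandoffH 3 ↔ WeilPositivityOn (Real.log 5 / 2) := by
  rw [handoffH_iff_weilPositivityOn Nat.prime_three, nextPrime_three]
  norm_num

/-! ## §2  The first failing window under `¬RH`, and the vacuity trap of the increment form -/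

/-- Under `¬RH` the failure is located in ONE window: there is a prime `q₁ ≥ 3` with `H(q)` for all primes `q < q₁`
and `¬ H(q)` for all primes `q ≥ q₁` (nestedness + `H 2`). [cite: Yoshida1992HermitianForms, Prop. 6 (p. 320)] -/
theorem exists_first_failure_of_not_riemannHypothesis (hRH : ¬ Summit.RiemannHypothesis) :
    ∃ q : ℕ, q.Prime ∧ 3 ≤ q ∧ (∀ q' : ℕ, q'.Prime → q' < q → HandoffH q') ∧
      ∀ q'' : ℕ, q''.Prime → q ≤ q'' → ¬ HandoffH q'' := by
  rw [riemannHypothesis_iff_forall_handoffH] at hRH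
  push Not at hRH
  classical
  let q := Nat.find hRH
  have hq : q.Prime ∧ ¬ HandoffH q := Nat.find_spec hRH
  refine ⟨q, hq.1, ?_, fun q' hq' hlt ↦ ?_, fun q'' hq'' hle hH ↦ hq.2 (hH.anti hq'' hq.1 hle)⟩
  · by_contra h3
    have h2 : q = 2 := by
      have := hq.1.two_le
      omega
    exact hq.2 (h2 ▸ handoffH_two)
  · by_contra hH
    exact Nat.find_min hRH hlt ⟨hq', hH⟩

/-- **VACUITY TRAP** (idea-1 §0 / prove-1 §1, confirmed): `∃ q₀, ∀ primes q ≥ q₀, HandoffStep q` is a THEOREM,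
unconditionally (excluded middle: under RH every step holds; under `¬RH` every step past the first failing window has
a FALSE hypothesis).  Hence «the increment holds for all large q» is NOT a meaningful target — only `Base ∧ ∀ q` is.
[cite: Yoshida1992HermitianForms, Prop. 6 (p. 320)] -/
theorem exists_forall_handoffStep : ∃ q₀ : ℕ, ∀ q : ℕ, q.Prime → q₀ ≤ q → HandoffStep q := by
  by_cases hRH : Summit.RiemannHypothesis
  · exact ⟨0, fun q hq _ _ ↦ handoffH_of_riemannHypothesis hRH hq⟩
  · obtain ⟨q₁, hq₁, -, -, hfail⟩ := exists_first_failure_of_not_riemannHypothesis hRH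
    refine ⟨nextPrime q₁, fun q hq hle hpos ↦ absurd ?_ (hfail q₁ hq₁ le_rfl)⟩
    -- positivity on `C((log q)/2)` with `q ≥ q₁⁺` would give `H q₁`
    rw [handoffH_iff_weilPositivityOn hq₁]
    refine hpos.mono ?_
    have h1 : (nextPrime q₁ : ℝ) ≤ q := by exact_mod_cast hle
    have h2 := Real.log_le_log (by exact_mod_cast (nextPrime_prime q₁).pos) h1
    linarith

/-! ## §3  The aggregate shadow: the sharp edge-layer bound and the old form's Rayleigh bottom -/

/-- The cell's CAP of the prime `q`: `cap(q) = (log q)/√q = w_q/2` — the largest contribution the atom `q` can make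
per unit `‖g‖₂²` on its window (prove-1 ATTEMPT-1 §2; conj-1's PREREG-H7-H11 normalises by it). [folklore] -/
def handoffCap (q : ℕ) : ℝ := Real.log q / Real.sqrt q

/-- `cap(q) ≥ 0`. [folklore] -/
theorem handoffCap_nonneg (q : ℕ) : 0 ≤ handoffCap q := by
  unfold handoffCap
  rcases Nat.eq_zero_or_pos q with rfl | hq
  · simp
  · have := Real.log_nonneg (show (1 : ℝ) ≤ q by exact_mod_cast hq)
    positivity

/-- On the handoff window the shift `log q` is STRICTLY larger than the half-width: `(log q⁺)/2 < log q` (q prime;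
`q⁺ < 2q ≤ q²` since `2q` is not prime). [folklore] -/
theorem log_nextPrime_half_lt_log (hq : q.Prime) : Real.log (nextPrime q) / 2 < Real.log q := by
  have hle : nextPrime q ≤ 2 * q := (consecutivePrimes_nextPrime hq).le_two_mul
  have hne : nextPrime q ≠ 2 * q := fun h ↦
    Nat.not_prime_mul (by norm_num) hq.one_lt.ne' (h ▸ nextPrime_prime q)
  have hlt : (nextPrime q : ℝ) < 2 * q := by exact_mod_cast lt_of_le_of_ne hle hne
  have h2 : (2 : ℝ) * q ≤ (q : ℝ) ^ 2 := by
    have : (2 : ℝ) ≤ q := by exact_mod_cast hq.two_le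
    nlinarith
  have hpos : (0 : ℝ) < nextPrime q := by exact_mod_cast (nextPrime_prime q).pos
  have h3 : Real.log (nextPrime q) < Real.log ((q : ℝ) ^ 2) := Real.log_lt_log hpos (hlt.trans_le h2)
  rw [Real.log_pow] at h3; push_cast at h3; linarith

/-- **The sharp edge-layer bound** (HANDOFF-STATEMENT.md §A.4; prove-1 ATTEMPT-1 §2): if `tsupport g ⊆ [−t, t]` and
`t < L` then `|k_g(L)| ≤ ½‖g‖₂²` — the integrand `g(u) conj g(u − L)` pairs the RIGHT layer `g|[L−t, t]` with the
LEFT layer `g|[−t, t−L]`, which are disjoint, so Cauchy–Schwarz and `2ab ≤ a² + b²` lose nothing to overlap.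
(Bombieri's Lemma 2 `|k| ≤ ‖g‖₂²`, tree `norm_weilConv_weilReflect_le`, is the bound without the support
information.) [cite: Bombieri2000Weil, §4 Lemma 2 (method)] -/
theorem norm_weilConv_weilReflect_le_half (hg : IsWeilTest g) {t L : ℝ} (htL : t < L)
    (hsupp : tsupport g ⊆ Icc (-t) t) :
    ‖weilConv g (weilReflect g) L‖ ≤ weilNorm2Sq g / 2 := by
  have hsup := support_subset_Ioo_of_tsupport_subset_Icc hg.1.continuous hsupp
  have hzero : ∀ x, x ∉ Ioo (-t) t → g x = 0 := fun x hx ↦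
    Function.notMem_support.1 fun h ↦ hx (hsup h)
  -- the right layer `gR = g·1_{u ≥ L − t}` and the left layer `gL = g·1_{u < L − t}`
  set gR : ℝ → ℂ := (Ici (L - t)).indicator g with hgR
  set gL : ℝ → ℂ := (Iio (L - t)).indicator g with hgL
  have hsplit : ∀ u, g u * weilReflect g (L - u) = gR u * conj (gL (u - L)) := by
    intro u
    simp only [weilReflect, neg_sub, hgR, hgL, Set.indicator_apply, mem_Ici, mem_Iio]
    by_cases hu : L - t ≤ u
    · rw [if_pos hu]
      by_cases hu2 : u - L < L - t
      · rw [if_pos hu2]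
      · rw [if_neg hu2]
        have hgu : g u = 0 := hzero u fun h ↦ by
          have := (mem_Ioo.1 h).2
          linarith [not_lt.1 hu2]
        simp [hgu]
    · rw [if_neg hu]
      have hgu : g (u - L) = 0 := hzero (u - L) fun h ↦ by
        have := (mem_Ioo.1 h).1
        linarith [not_le.1 hu]
      simp [hgu]
  have h2 : Integrable fun u : ℝ ↦ ‖g u‖ ^ 2 := hg.integrable_norm_sq
  have hRsq : (fun u : ℝ ↦ ‖gR u‖ ^ 2) = (Ici (L - t)).indicator (fun u ↦ ‖g u‖ ^ 2) := by
    funext u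
    simp only [hgR, Set.indicator_apply, mem_Ici]
    split_ifs <;> simp
  have hLsq : (fun u : ℝ ↦ ‖gL u‖ ^ 2) = (Iio (L - t)).indicator (fun u ↦ ‖g u‖ ^ 2) := by
    funext u
    simp only [hgL, Set.indicator_apply, mem_Iio]
    split_ifs <;> simp
  have hR2 : Integrable fun u : ℝ ↦ ‖gR u‖ ^ 2 := by rw [hRsq]; exact h2.indicator measurableSet_Ici
  have hL2 : Integrable fun u : ℝ ↦ ‖gL u‖ ^ 2 := by rw [hLsq]; exact h2.indicator measurableSet_Iio
  have hL2' : Integrable fun u : ℝ ↦ ‖gL (u - L)‖ ^ 2 := hL2.comp_sub_right L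
  have hsum : (fun u : ℝ ↦ ‖gR u‖ ^ 2 + ‖gL u‖ ^ 2) = fun u ↦ ‖g u‖ ^ 2 := by
    funext u
    simp only [hgR, hgL, Set.indicator_apply, mem_Ici, mem_Iio]
    by_cases hu : L - t ≤ u
    · rw [if_pos hu, if_neg (not_lt.2 hu)]; simp
    · rw [if_neg hu, if_pos (not_le.1 hu)]; simp
  rw [weilConv_apply]
  calc ‖∫ u : ℝ, g u * weilReflect g (L - u)‖
      ≤ ∫ u : ℝ, ‖g u * weilReflect g (L - u)‖ := norm_integral_le_integral_norm _
    _ ≤ ∫ u : ℝ, (‖gR u‖ ^ 2 + ‖gL (u - L)‖ ^ 2) / 2 := by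
        refine integral_mono_of_nonneg (Filter.Eventually.of_forall fun _ ↦ norm_nonneg _)
          ((hR2.add hL2').div_const 2) (Filter.Eventually.of_forall fun u ↦ ?_)
        simp only [hsplit u, norm_mul, Complex.norm_conj]
        linarith [two_mul_le_add_sq ‖gR u‖ ‖gL (u - L)‖]
    _ = ((∫ u : ℝ, ‖gR u‖ ^ 2) + ∫ u : ℝ, ‖gL u‖ ^ 2) / 2 := by
        rw [integral_div, integral_add hR2 hL2', integral_sub_right_eq_self (fun u : ℝ ↦ ‖gL u‖ ^ 2) L]
    _ = weilNorm2Sq g / 2 := by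
        rw [← integral_add hR2 hL2, hsum]
        rfl

/-- **Contribution is capped**: on the window of a prime `q` (indeed for every `g ∈ C((log q⁺)/2)`),
`|contribution q g| ≤ cap(q) ‖g‖₂²` with `cap(q) = (log q)/√q` (sharp: attained by antisymmetric two-layer pairs,
HANDOFF-STATEMENT.md §D.1). [folklore] -/
theorem abs_contribution_le (hq : q.Prime) (hg : IsWeilTest g)
    (hsupp : tsupport g ⊆ Icc (-(Real.log (nextPrime q) / 2)) (Real.log (nextPrime q) / 2)) :
    |Handoff.contribution q g| ≤ handoffCap q * weilNorm2Sq g := by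
  have hk := norm_weilConv_weilReflect_le_half hg (log_nextPrime_half_lt_log hq) hsupp
  have hre := (Complex.abs_re_le_norm (weilConv g (weilReflect g) (Real.log q))).trans hk
  rw [contribution_eq_two_mul, abs_neg, abs_mul, show |2 * Real.log q / Real.sqrt q| = 2 * handoffCap q by
    unfold handoffCap; rw [abs_of_nonneg]; · ring
    · have := handoffCap_nonneg q; unfold handoffCap at this; positivity]
  have hc := handoffCap_nonneg q
  nlinarith

/-- **The aggregate shadow of `H(q)`** (necessary, NOT sufficient): `H(q)` forces, for every `g ∈ C((log q⁺)/2)`,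
`deficit q g ≤ cap(q) ‖g‖₂²`, i.e. the Rayleigh bottom of the OLD form `Q_{S_q}` on the window is `≥ −(log q)/√q`
— the cell's «load» `r(q) = D_q/cap(q) ≤ 1`.  A certified Ritz value below `−cap(q)` on the window would refute RH.
[folklore] -/
theorem HandoffH.deficit_le (hq : q.Prime) (h : HandoffH q) (hg : IsWeilTest g)
    (hsupp : tsupport g ⊆ Icc (-(Real.log (nextPrime q) / 2)) (Real.log (nextPrime q) / 2)) :
    Handoff.deficit q g ≤ handoffCap q * weilNorm2Sq g := by
  have hle := h _ ⟨?_, le_rfl⟩ g hg hsupp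
  · exact hle.trans ((le_abs_self _).trans (abs_contribution_le hq hg hsupp))
  · have h := Real.log_le_log (by exact_mod_cast hq.pos) (show (q : ℝ) ≤ nextPrime q by
      exact_mod_cast (lt_nextPrime q).le)
    linarith

/-- **The aggregate (Rayleigh-quotient) norm bound at `q`**, `N(q)` of the cell: the deficit of the OLD form on the
window is at most `cap(q) ‖g‖₂²` — a statement about `λ_min` of the RH-free form `Q_{S_q}` on `C((log q⁺)/2)`,
implied by `H(q)` (`HandoffH.normBound`) but NOT implying it (prove-1 ATTEMPT-1 §2–§4; conj-1 pre-registers the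
load `r = D/cap`). [folklore] -/
def HandoffNormBound (q : ℕ) : Prop :=
  ∀ g : ℝ → ℂ, IsWeilTest g → tsupport g ⊆ Icc (-(Real.log (nextPrime q) / 2)) (Real.log (nextPrime q) / 2) →
    Handoff.deficit q g ≤ handoffCap q * weilNorm2Sq g

/-- `H(q) ⟹ N(q)` (q prime). [folklore] -/
theorem HandoffH.normBound (hq : q.Prime) (h : HandoffH q) : HandoffNormBound q :=
  fun _ hg hsupp ↦ h.deficit_le hq hg hsupp

/-- On `C((log q)/2)` the old form IS Weil's form: `deficit q g = − Re Q(g)` (q prime). [folklore] -/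
theorem deficit_eq_of_narrow (hq : q.Prime) (hg : IsWeilTest g)
    (hsupp : tsupport g ⊆ Icc (-(Real.log q / 2)) (Real.log q / 2)) :
    Handoff.deficit q g = -(weilQuadratic g).re := by
  have hS : ∀ n ≤ q - 1, IsPrimePow n → n.primeFactors ⊆ Nat.primesBelow (q - 1 + 1) :=
    fun n hn _ ↦ primeFactors_subset_primesBelow hn
  rw [Nat.sub_add_cancel hq.one_lt.le] at hS
  have hsupp' : tsupport g ⊆ Icc (-(Real.log (((q - 1 : ℕ) : ℝ) + 1) / 2)) (Real.log (((q - 1 : ℕ) : ℝ) + 1) / 2) := by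
    rwa [show ((q - 1 : ℕ) : ℝ) + 1 = q by exact_mod_cast Nat.sub_add_cancel hq.one_lt.le]
  unfold Handoff.deficit
  rw [weilSemilocalQuadratic_eq_weilQuadratic_of_forall hg hS hsupp']

/-- `cap(q) = (log q)/√q → 0`. [folklore] -/
theorem tendsto_handoffCap : Filter.Tendsto (fun q : ℕ ↦ handoffCap q) Filter.atTop (nhds 0) := by
  have h1 : Filter.Tendsto (fun x : ℝ ↦ Real.log x / x ^ (1 / 2 : ℝ)) Filter.atTop (nhds 0) :=
    (isLittleO_log_rpow_atTop (by norm_num : (0 : ℝ) < 1 / 2)).tendsto_div_nhds_zero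
  have h2 : Filter.Tendsto (fun q : ℕ ↦ Real.log q / (q : ℝ) ^ (1 / 2 : ℝ)) Filter.atTop (nhds 0) :=
    h1.comp tendsto_natCast_atTop_atTop
  refine h2.congr fun q ↦ ?_
  unfold handoffCap
  rw [Real.sqrt_eq_rpow]

/-- **UNIFORMITY AT THE NORM LEVEL IS RH** (prove-1 ATTEMPT-1 Thm 2, typed): if `N(q)` holds for INFINITELY MANY
primes `q`, then RH — because on `C((log q)/2)` the old form is Weil's form, so `N(q)` gives
`Re Q(g) ≥ −cap(q) ‖g‖²` on `C((log q)/2)`, and `cap(q) → 0` while the windows exhaust every `C(a)`.  Conversely RH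
gives `N(q)` for every prime `q`.  (At FIXED `q`, `N(q)` does not give `H(q)`.) [cite: Bombieri2000Weil, Thm. 2 (criterion); §4] -/
theorem riemannHypothesis_of_frequently_normBound
    (h : ∀ N : ℕ, ∃ q : ℕ, N ≤ q ∧ q.Prime ∧ HandoffNormBound q) : Summit.RiemannHypothesis := by
  rw [MotivicDoor.Rungs.rung_R0]
  intro a ha g hg hsupp
  -- `Re Q(g) > c` for every `c < 0`
  refine le_of_forall_lt fun c hc ↦ ?_
  have hε : 0 < -c := by linarith
  -- eventually `cap(q) · ‖g‖² < −c`
  have hev : ∀ᶠ q : ℕ in Filter.atTop, handoffCap q * weilNorm2Sq g < -c := by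
    have hlim : Filter.Tendsto (fun q : ℕ ↦ handoffCap q * weilNorm2Sq g) Filter.atTop (nhds 0) := by
      simpa using tendsto_handoffCap.mul_const (weilNorm2Sq g)
    exact (hlim.eventually (gt_mem_nhds hε))
  obtain ⟨N₁, hN₁⟩ := Filter.eventually_atTop.1 hev
  obtain ⟨q, hq, hqp, hNB⟩ := h (max N₁ (⌈Real.exp (2 * a)⌉₊ + 1))
  have hN₁q : N₁ ≤ q := le_trans (le_max_left _ _) hq
  have hqa : a ≤ Real.log q / 2 := by
    have h1 : Real.exp (2 * a) ≤ q := by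
      have := Nat.le_ceil (Real.exp (2 * a))
      have h' : (⌈Real.exp (2 * a)⌉₊ : ℝ) + 1 ≤ q := by
        have := le_trans (le_max_right _ _) hq
        exact_mod_cast this
      linarith
    have h3 : 2 * a ≤ Real.log q := by
      rw [Real.le_log_iff_exp_le (by linarith [Real.exp_pos (2 * a)])]
      exact h1
    linarith
  have hsupp1 : tsupport g ⊆ Icc (-(Real.log q / 2)) (Real.log q / 2) :=
    hsupp.trans (Icc_subset_Icc (neg_le_neg hqa) hqa)
  have hsupp2 : tsupport g ⊆ Icc (-(Real.log (nextPrime q) / 2)) (Real.log (nextPrime q) / 2) := by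
    refine hsupp1.trans (Icc_subset_Icc (neg_le_neg ?_) ?_) <;>
    · have := Real.log_le_log (by exact_mod_cast hqp.pos) (show (q : ℝ) ≤ nextPrime q by
        exact_mod_cast (lt_nextPrime q).le)
      linarith
  have hd := hNB g hg hsupp2
  rw [deficit_eq_of_narrow hqp hg hsupp1] at hd
  have := hN₁ q hN₁q
  linarith

/-- **`RH ↔ ∀ q prime, N(q)` ↔ `N(q)` for infinitely many primes `q`.** The aggregate shadow is equivalent to RH
IN THE LIMIT (uniformity in `q`), not window by window. [cite: Bombieri2000Weil, Thm. 2] -/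
theorem riemannHypothesis_iff_forall_normBound :
    Summit.RiemannHypothesis ↔ ∀ q : ℕ, q.Prime → HandoffNormBound q := by
  refine ⟨fun hRH q hq ↦ (handoffH_of_riemannHypothesis hRH hq).normBound hq, fun h ↦ ?_⟩
  refine riemannHypothesis_of_frequently_normBound fun N ↦ ?_
  obtain ⟨q, hNq, hq⟩ := Nat.exists_infinite_primes N
  exact ⟨q, hNq, hq, h q hq⟩

end Summit.RiemannHypothesis.RiemannHypothesis.Theorems.HandoffDecomposition

end
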